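import Literature.MathematicalPhysics.QuantumFieldTheory.BalabanImbrieJaffe1984to88.BIJ88FTCExpansion305

/-!
# `BalabanImbrieJaffe1984to88.BIJ88ExpansionSumBound305` — T. Bałaban, J. Imbrie, A. Jaffe, *Effective action and cluster properties of the
abelian Higgs model*, Commun. Math. Phys. **114** (1988) 257–315 [BalabanImbrieJaffe1988]: p. 305 [PDF 49] (Sect. 5.13, the interpolation
`Σ_{Γ⊂I} ∫ds_Γ (∂/∂s_Γ)⟨·⟩_{s_Γ}`, *"s_i = 0 for i ∉ Γ"*, *"ds_Γ = Π_{i∈Γ} ds_i"*) and p. 307 [PDF 51] (*"Estimating the sums over S_γ,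
S_δ, and the sums in the cluster expansion leads to combinatoric factors"*) — **THE SIZE OF THE INTERPOLATION SUM: EACH `∫ds_Γ` IS BOUNDED
BY THE SUPREMUM OF ITS INTEGRAND OVER THE CUBE `[0,1]^Γ`**.

p02's `BIJ88FTCExpansion305.expansionSum l D σ = Σ_{Γ ∈ sublists l} iterInt Γ (D Γ) σ` (`iterInt` = the iterated `∫₀¹`) is the outer
structure of the located (5.13.3) (`BIJ88WalkFormLocated309.expect_fD_uD_eq_expansionSum_trains`, with `l` = all cubes and `σ = 0`).  THIS
FILE: `|iterInt Γ g σ| ≤ B` as soon as `|g s| ≤ B` on the cube `{s : s_i ∈ [0,1] (i ∈ Γ), s_i = σ_i (i ∉ Γ)}` (`abs_iterInt_le`, induction on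
`Γ`, `‖∫₀¹f‖ ≤ sup‖f‖`); hence `|expansionSum l D σ| ≤ Σ_{Γ ∈ sublists l} B_Γ` for cube-wise bounds `B_Γ` (`abs_expansionSum_le`) and
`≤ 2^{|l|}·B` for a uniform one (`abs_expansionSum_le_pow`) — the `Σ_Γ` is paid by the small factors per differentiated boundary that the
integrand bounds `B_Γ` carry (p. 307), not here.  The cube at `σ = 0` lies in `[0,1]^I` (`mem_unitCube_of_cube_zero`), the parameter
range in which `BIJ88GaussShellInterpolated309` / `BIJ88CsDecay305` hold uniformly.

statement-level skeleton of published theorems with citation tags; proofs where landed; nothing here is a claim about the Yang–Mills mass gap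

PDF held: `paper:balaban1988-cmp114-bij-abelian-higgs-effective-action` (journal page = PDF page + 256); pages re-read this session as text:
PDF 49 (p. 305), PDF 51 (p. 307) L19–24.

CITATION HEADER (lean-in-tree rule).  Part of the lit-balaban TYPED SKELETON (HOME `run/shared/lean/pub/lit-balaban/`), Phase 2, seat p36
(gen 21, unit `lit-balaban-p36`); rows **C2.Eq5.14.3-5.14.4** (member: §f estimate E4f — the outermost sum/integral of the assembly) and
C2.Eq5.13.3-5.13.4 (member: size of p02's `expansionSum`) of `HOME/lit-balaban-r16/ROWS-C2-part2.md` (owner r16, referee ref-5).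
Theorem-only; no definitions, no `Prop` facts; axioms standard; Mathlib + `BIJ88FTCExpansion305` only.
-/

namespace Literature.MathematicalPhysics.QuantumFieldTheory.BalabanImbrieJaffe1984to88.BIJ88ExpansionSumBound305

open Function MeasureTheory
open scoped BigOperators
open BIJ88FTCExpansion305 (iterInt expansionSum)

variable {I : Type*} [DecidableEq I]

/-- **`|∫ds_Γ g| ≤ sup_{cube} |g|`**: if `|g s| ≤ B` for every `s` with `s_i ∈ [0,1]` for `i ∈ Γ` and `s_i = σ_i` for `i ∉ Γ`, then
`|iterInt Γ g σ| ≤ B` (each `∫₀¹` is bounded by the supremum of its integrand; no measurability needed).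
[cite: BalabanImbrieJaffe1988, (5.13.3) p.305] -/
theorem abs_iterInt_le : ∀ (Γ : List I) (g : (I → ℝ) → ℝ) (σ : I → ℝ) (B : ℝ),
    (∀ s : I → ℝ, (∀ i ∈ Γ, s i ∈ Set.Icc (0 : ℝ) 1) → (∀ i ∉ Γ, s i = σ i) → |g s| ≤ B) → |iterInt Γ g σ| ≤ B
  | [], g, σ, B, h => h σ (fun i hi => absurd hi List.not_mem_nil) (fun _ _ => rfl)
  | (i :: Γ), g, σ, B, h => by
      show |∫ t in (0 : ℝ)..1, iterInt Γ g (update σ i t)| ≤ B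
      have hB : ∀ t ∈ Set.uIoc (0 : ℝ) 1, ‖iterInt Γ g (update σ i t)‖ ≤ B := by
        intro t ht
        rw [Set.uIoc_of_le zero_le_one] at ht
        rw [Real.norm_eq_abs]
        refine abs_iterInt_le Γ g (update σ i t) B fun s hs hσ => h s (fun j hj => ?_) (fun j hj => ?_)
        · rcases List.mem_cons.1 hj with rfl | hjΓ
          · by_cases hjm : j ∈ Γ
            · exact hs j hjm
            · rw [hσ j hjm, update_self]
              exact ⟨ht.1.le, ht.2⟩
          · exact hs j hjΓ
        · have hji : j ≠ i := fun e => hj (e ▸ List.mem_cons_self ..)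
          rw [hσ j fun hjΓ => hj (List.mem_cons_of_mem i hjΓ), update_of_ne hji]
      have h1 := intervalIntegral.norm_integral_le_of_norm_le_const hB
      rwa [Real.norm_eq_abs, sub_zero, abs_one, mul_one] at h1

/-- the cube over `Γ` based at `σ = 0` lies in the unit cube `[0,1]^I` (print: *"s_i = 0 for i ∉ Γ"*) — the range in which the interpolated
covariance and the Gaussian shell bounds hold uniformly. [cite: BalabanImbrieJaffe1988, (5.13.3) p.305] -/
theorem mem_unitCube_of_cube_zero {Γ : List I} {s : I → ℝ} (hs : ∀ i ∈ Γ, s i ∈ Set.Icc (0 : ℝ) 1)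
    (h0 : ∀ i ∉ Γ, s i = (0 : I → ℝ) i) (i : I) : 0 ≤ s i ∧ s i ≤ 1 := by
  by_cases hi : i ∈ Γ
  · exact ⟨(hs i hi).1, (hs i hi).2⟩
  · rw [h0 i hi, Pi.zero_apply]
    exact ⟨le_rfl, zero_le_one⟩

/-- sums of a list dominated termwise: `|Σ f| ≤ Σ g` if `|f x| ≤ g x` on the list. [folklore] [cite: BalabanImbrieJaffe1988, §5.13 p.307] -/
theorem abs_sum_map_le {κ : Type*} : ∀ (L : List κ) (f g : κ → ℝ), (∀ x ∈ L, |f x| ≤ g x) → |(L.map f).sum| ≤ (L.map g).sum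
  | [], _, _, _ => by simp
  | (x :: L), f, g, h => by
      simp only [List.map_cons, List.sum_cons]
      exact (abs_add_le _ _).trans
        (add_le_add (h x (List.mem_cons_self ..)) (abs_sum_map_le L f g fun y hy => h y (List.mem_cons_of_mem x hy)))

/-- **`|Σ_Γ ∫ds_Γ D_Γ| ≤ Σ_Γ B_Γ`** for cube-wise bounds `|D_Γ(s)| ≤ B_Γ` (`s` in the cube over `Γ` based at `σ`).
[cite: BalabanImbrieJaffe1988, (5.13.3) p.305, §5.13 p.307] -/
theorem abs_expansionSum_le (l : List I) (D : Finset I → (I → ℝ) → ℝ) (σ : I → ℝ) (B : Finset I → ℝ)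
    (h : ∀ Γ ∈ l.sublists', ∀ s : I → ℝ, (∀ i ∈ Γ, s i ∈ Set.Icc (0 : ℝ) 1) → (∀ i ∉ Γ, s i = σ i) → |D Γ.toFinset s| ≤ B Γ.toFinset) :
    |expansionSum l D σ| ≤ (l.sublists'.map fun Γ => B Γ.toFinset).sum := by
  unfold expansionSum
  exact abs_sum_map_le _ _ _ fun Γ hΓ => abs_iterInt_le Γ _ σ _ (h Γ hΓ)

/-- **… at the printed base point `σ = 0`**, where every cube lies in `[0,1]^I`: bounds on the unit cube suffice.
[cite: BalabanImbrieJaffe1988, (5.13.3) p.305, §5.13 p.307] -/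
theorem abs_expansionSum_zero_le (l : List I) (D : Finset I → (I → ℝ) → ℝ) (B : Finset I → ℝ)
    (h : ∀ (Γ : Finset I) (s : I → ℝ), (∀ i, 0 ≤ s i ∧ s i ≤ 1) → |D Γ s| ≤ B Γ) :
    |expansionSum l D 0| ≤ (l.sublists'.map fun Γ => B Γ.toFinset).sum :=
  abs_expansionSum_le l D 0 B fun Γ _ s hs h0 => h Γ.toFinset s (mem_unitCube_of_cube_zero hs h0)

/-- **the combinatoric factor of the interpolation sum**: a uniform bound `B` on the unit cube gives `|Σ_Γ ∫ds_Γ D_Γ| ≤ 2^{|l|}·B`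
(`2^{|l|}` subsets; p. 307 *"combinatoric factors"*, beaten by the small factors per cube carried by the actual `B_Γ`).
[cite: BalabanImbrieJaffe1988, (5.13.3) p.305, §5.13 p.307] -/
theorem abs_expansionSum_zero_le_pow (l : List I) (D : Finset I → (I → ℝ) → ℝ) {B : ℝ}
    (h : ∀ (Γ : Finset I) (s : I → ℝ), (∀ i, 0 ≤ s i ∧ s i ≤ 1) → |D Γ s| ≤ B) :
    |expansionSum l D 0| ≤ 2 ^ l.length * B := by
  refine (abs_expansionSum_zero_le l D (fun _ => B) h).trans (le_of_eq ?_)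
  rw [List.map_const', List.sum_replicate, List.length_sublists', nsmul_eq_mul, Nat.cast_pow, Nat.cast_ofNat]

end Literature.MathematicalPhysics.QuantumFieldTheory.BalabanImbrieJaffe1984to88.BIJ88ExpansionSumBound305
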